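import Summits.CriticalPhenomena.SAWScalingLimit.Theses.SAWTotalPositivity
import Literature.Barriers.CriticalPhenomena.SupercriticalSAWSpaceFillingSteps
import Literature.Probability.RandomPlanarGeometry.SupercriticalSAWProp3Holds
import Literature.Probability.RandomPlanarGeometry.SAWPolygonOpening
import Literature.Probability.RandomPlanarGeometry.SAWSusceptibility
import Literature.Probability.RandomPlanarGeometry.BDGS2012Prop13
import Literature.Probability.RandomPlanarGeometry.SAWBubbleBound
import Literature.Probability.RandomPlanarGeometry.SelfAvoidingWalkCert
import Literature.Probability.RandomPlanarGeometry.SelfAvoidingWalkProofs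
import Literature.Probability.RandomPlanarGeometry.SAWTargetOrder


/-!
# Negative-side results for the crux `SAWTotalPositivity.CriticalBubbleBound` (stmt-CriticalPhenomena-7117):
the lattice kernel `K_x(u,v)`, hypothesis-free domain monotonicity, disk exhaustion, translation invariance and the normal form `CriticalBubbleBound ⟺ ∃ C < ∞, ∀ u ∼ v, K_{x_c}(u,v) ≤ C ⟺ ∀ unit e, G_{x_c}(0,e) < ∞` (work-file §0–§1).

Refuter `cdisprove` (standing adversary); the full indexed work file is
`Summits/CriticalPhenomena/SAWScalingLimit/Cruxes/CriticalBubbleBound/Disproof.lean`.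
-/

noncomputable section

open MeasureTheory Filter Topology Set Function
open Literature.Probability.LatticeModels Literature.Probability.Percolation
open Literature.Probability.RandomPlanarGeometry Literature.Probability.RandomPlanarGeometry.SAW
open Literature.Barriers.CriticalPhenomena.SupercriticalSAW
open scoped ENNReal NNReal BigOperators

namespace Summit.CriticalPhenomena.SAWScalingLimit.Theorems.CriticalBubbleBound.Negative

open Summit.CriticalPhenomena.SAWScalingLimit.Theses.SAWTotalPositivity (CriticalBubbleBound)

/-! ## §0 Read-back of the crux -/

/-- READ-BACK. The crux, unfolded: one constant `C < ∞` dominating the critical two-point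
partition function `Z_Ω(u,v) = Σ_{γ : u → v SAW of Ω_δ} x_c^{|γ|}` (`SAW.weight Ω δ u v univ`)
for every bounded `Ω ⊆ ℂ`, every `δ > 0` and every pair of `ℤ²`-neighbours `u ∼ v` (adjacent in
`zdGraph 2`, NOT required to be joined in `Ω_δ`, nor to lie in `Ω_δ`: if `u ∉ Ω_δ` the weight is
`0`). No junk: `C : ℝ≥0∞` with `C ≠ ⊤`; the weight is a genuine `[0,∞]`-valued sum. [folklore] -/
theorem criticalBubbleBound_iff :
    CriticalBubbleBound ↔
      ∃ C : ℝ≥0∞, C ≠ ⊤ ∧ ∀ (Ω : Set ℂ) (δ : ℝ) (u v : Site 2), Bornology.IsBounded Ω → 0 < δ →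
        (zdGraph 2).Adj u v → SAW.weight Ω δ u v univ ≤ C :=
  Iff.rfl

/-! ## §1 The lattice kernel `K_x(u,v) = Σ_{γ : u → v SAW of ℤ²} x^{|γ|}` and domain monotonicity -/

/-- Self-avoiding walks of the full lattice `ℤ²` from `u` to `v` (paths of `zdGraph 2`). [folklore] -/
abbrev LatticeSAW (u v : Site 2) : Type := {p : (zdGraph 2).Walk u v // p.IsPath}

/-- The fugacity-`x` two-point kernel of the FULL lattice,
`K_x(u,v) = Σ_{γ : u → v SAW of ℤ²} x^{|γ|} ∈ [0, ∞]` (an `ℝ≥0∞`-valued `tsum`, no convergence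
issue). At `x = x_c` and `v = u + e` this is the "critical bubble" `G_{z_c}(0,e)` of
Madras–Slade. [cite: MadrasSlade1993, §1.4 (critical two-point function)] -/
def latticeKernel (x : ℝ) (u v : Site 2) : ℝ≥0∞ :=
  ∑' p : LatticeSAW u v, ENNReal.ofReal (x ^ p.1.length)

/-- The fugacity-`x` weight of a measurable (= any) set of domain SAWs as a `tsum` of
`x^{|γ|}` over the set. [folklore] -/
theorem weightAt_apply (x : ℝ) {Ω : Set ℂ} {δ : ℝ} {u v : Site 2} (A : Set (DomainSAW Ω δ u v)) :
    weightAt x Ω δ u v A = ∑' γ, A.indicator (fun γ => ENNReal.ofReal (x ^ γ.length)) γ := by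
  rw [weightAt, Measure.sum_apply _ MeasurableSpace.measurableSet_top]
  congr 1
  funext γ
  rw [Measure.smul_apply, Measure.dirac_apply' _ MeasurableSpace.measurableSet_top, smul_eq_mul]
  by_cases hγ : γ ∈ A
  · simp [Set.indicator_of_mem hγ]
  · simp [Set.indicator_of_notMem hγ]

/-- The total fugacity-`x` weight `Z^x_Ω(u,v) = Σ_γ x^{|γ|}`. [folklore] -/
theorem weightAt_univ (x : ℝ) (Ω : Set ℂ) (δ : ℝ) (u v : Site 2) :
    weightAt x Ω δ u v univ = ∑' γ : DomainSAW Ω δ u v, ENNReal.ofReal (x ^ γ.length) := by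
  rw [weightAt_apply]; simp

/-- The critical weight `Z_Ω(u,v) = Σ_γ x_c^{|γ|}`. [folklore] -/
theorem weight_univ (Ω : Set ℂ) (δ : ℝ) (u v : Site 2) :
    SAW.weight Ω δ u v univ = ∑' γ : DomainSAW Ω δ u v, ENNReal.ofReal (criticalFugacity ^ γ.length) := by
  rw [← weightAt_criticalFugacity, weightAt_univ]

/-- A SAW of `Ω_δ` IS a SAW of `ℤ²` (same vertex list): the forgetful map. [folklore] -/
def toLattice {Ω : Set ℂ} {δ : ℝ} {u v : Site 2} (γ : DomainSAW Ω δ u v) : LatticeSAW u v :=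
  ⟨γ.walk.mapLe (discreteDomainGraph_le_zdGraph Ω δ), γ.isPath.mapLe _⟩

/-- The forgetful map keeps the length. [folklore] -/
@[simp] theorem length_toLattice {Ω : Set ℂ} {δ : ℝ} {u v : Site 2} (γ : DomainSAW Ω δ u v) :
    (toLattice γ).1.length = γ.length :=
  SimpleGraph.Walk.length_map _ _

/-- The forgetful map keeps the support. [folklore] -/
@[simp] theorem support_toLattice {Ω : Set ℂ} {δ : ℝ} {u v : Site 2} (γ : DomainSAW Ω δ u v) :
    (toLattice γ).1.support = γ.walk.support :=
  SimpleGraph.Walk.support_mapLe_eq_support _ _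

/-- The forgetful map is injective (a walk is determined by its support). [folklore] -/
theorem toLattice_injective {Ω : Set ℂ} {δ : ℝ} {u v : Site 2} :
    Injective (toLattice : DomainSAW Ω δ u v → LatticeSAW u v) := by
  rintro ⟨p, hp⟩ ⟨q, hq⟩ h
  have h' := congrArg (fun r : LatticeSAW u v => r.1.support) h
  simp only [support_toLattice] at h'
  have := SimpleGraph.Walk.support_injective h'
  subst this
  rfl

/-- **Domain monotonicity, hypothesis-free.** For EVERY `Ω ⊆ ℂ` (bounded or not), EVERY real
`δ` (positive or not) and every fugacity `x`, the domain partition function is dominated by the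
full-lattice kernel: `Z^x_Ω(u,v) ≤ K_x(u,v)`. [folklore] -/
theorem weightAt_univ_le_latticeKernel (x : ℝ) (Ω : Set ℂ) (δ : ℝ) (u v : Site 2) :
    weightAt x Ω δ u v univ ≤ latticeKernel x u v := by
  rw [weightAt_univ, latticeKernel]
  calc ∑' γ : DomainSAW Ω δ u v, ENNReal.ofReal (x ^ γ.length)
      = ∑' γ : DomainSAW Ω δ u v, (fun p : LatticeSAW u v => ENNReal.ofReal (x ^ p.1.length)) (toLattice γ) := by
        simp
    _ ≤ ∑' p : LatticeSAW u v, ENNReal.ofReal (x ^ p.1.length) :=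
        ENNReal.tsum_comp_le_tsum_of_injective toLattice_injective _

/-- The critical case: `Z_Ω(u,v) ≤ K_{x_c}(u,v)` for every `Ω, δ`. [folklore] -/
theorem weight_univ_le_latticeKernel (Ω : Set ℂ) (δ : ℝ) (u v : Site 2) :
    SAW.weight Ω δ u v univ ≤ latticeKernel criticalFugacity u v := by
  rw [← weightAt_criticalFugacity]; exact weightAt_univ_le_latticeKernel _ Ω δ u v

/-! ### Exhaustion: every finite family of lattice SAWs lives in a discretised disk `𝔻_δ` -/

/-- Vertices of an `n`-step walk of `ℤ²` from `u` are within sup-distance `n` of `u`. [folklore] -/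
theorem abs_sub_le_length {u v : Site 2} (p : (zdGraph 2).Walk u v) :
    ∀ w ∈ p.support, ∀ i, |w i - u i| ≤ p.length := by
  induction p with
  | nil =>
    intro w hw i
    rw [SimpleGraph.Walk.support_nil, List.mem_singleton] at hw
    subst hw; simp
  | cons hadj q ih =>
    rename_i a b c
    intro w hw i
    rw [SimpleGraph.Walk.support_cons, List.mem_cons] at hw
    rw [SimpleGraph.Walk.length_cons]
    rcases hw with rfl | hw
    · simp only [sub_self, abs_zero]; positivity
    · have h1 := ih w hw i
      have h2 := Zd.abs_sub_le_one_of_adj hadj i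
      calc |w i - a i| = |(w i - b i) + (b i - a i)| := by ring_nf
        _ ≤ |w i - b i| + |b i - a i| := abs_add_le _ _
        _ ≤ (q.length : ℤ) + 1 := add_le_add h1 h2
        _ = ((q.length + 1 : ℕ) : ℤ) := by push_cast; ring

/-- The mesh `δ_N := 1/(2(N+1))`, at which every site of sup-norm `≤ N` lies in `𝔻_δ`. [folklore] -/
def meshOf (N : ℕ) : ℝ := 1 / (2 * ((N : ℝ) + 1))

/-- `δ_N > 0`. [folklore] -/
theorem meshOf_pos (N : ℕ) : 0 < meshOf N := by
  unfold meshOf; positivity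

/-- Every site of sup-norm `≤ N` is a vertex of `𝔻_{δ_N}`. [folklore] -/
theorem mem_meshDomain_unitDisk_of_abs_le {N : ℕ} {w : Site 2} (hw : ∀ i, |w i| ≤ N) :
    w ∈ meshDomain unitDisk (meshOf N) := by
  rw [meshDomain_unitDisk, mem_meshVertices_unitDisk_iff_sq]
  have hsq : ∀ i, ((w i : ℤ) : ℝ) ^ 2 ≤ (N : ℝ) ^ 2 := fun i => by
    have h1 : |((w i : ℤ) : ℝ)| ≤ (N : ℝ) := by
      rw [← Int.cast_abs]; exact_mod_cast hw i
    have h2 : (0 : ℝ) ≤ |((w i : ℤ) : ℝ)| := abs_nonneg _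
    nlinarith [sq_abs ((w i : ℤ) : ℝ)]
  have hsum : ∑ j, ((w j : ℤ) : ℝ) ^ 2 ≤ 2 * (N : ℝ) ^ 2 := by
    rw [Fin.sum_univ_two]; linarith [hsq 0, hsq 1]
  have hN : (0 : ℝ) ≤ N := Nat.cast_nonneg N
  unfold meshOf
  rw [div_pow, one_pow, mul_pow]
  have hpos : (0 : ℝ) < 2 ^ 2 * ((N : ℝ) + 1) ^ 2 := by positivity
  rw [div_mul_eq_mul_div, one_mul, div_lt_one hpos]
  nlinarith

/-- The edges of a lattice walk whose vertices lie in `𝔻_δ` are edges of the graph `𝔻_δ`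
(two neighbours of the disk are always joined: the closed disk is convex). [folklore] -/
theorem edges_mem_edgeSet_unitDisk {δ : ℝ} {u v : Site 2} (p : (zdGraph 2).Walk u v)
    (h : ∀ w ∈ p.support, w ∈ meshDomain unitDisk δ) :
    ∀ e ∈ p.edges, e ∈ (discreteDomainGraph unitDisk δ).edgeSet := by
  intro e he
  induction e using Sym2.ind with
  | h a b =>
    rw [SimpleGraph.mem_edgeSet]
    exact discreteDomainGraph_unitDisk_adj.2 ⟨p.adj_of_mem_edges he,
      h a (p.fst_mem_support_of_mem_edges he), h b (p.snd_mem_support_of_mem_edges he)⟩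

/-- Transfer of a lattice SAW with vertices in `𝔻_δ` to a SAW of `𝔻_δ`. [folklore] -/
def toDisk (δ : ℝ) {u v : Site 2} (p : LatticeSAW u v)
    (h : ∀ w ∈ p.1.support, w ∈ meshDomain unitDisk δ) : DomainSAW unitDisk δ u v :=
  ⟨p.1.transfer _ (edges_mem_edgeSet_unitDisk p.1 h), p.2.transfer _⟩

/-- The transfer keeps the length. [folklore] -/
@[simp] theorem length_toDisk (δ : ℝ) {u v : Site 2} (p : LatticeSAW u v)
    (h : ∀ w ∈ p.1.support, w ∈ meshDomain unitDisk δ) : (toDisk δ p h).length = p.1.length :=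
  SimpleGraph.Walk.length_transfer _ _

/-- The transfer keeps the support, hence is injective. [folklore] -/
theorem toDisk_inj (δ : ℝ) {u v : Site 2} {p q : LatticeSAW u v}
    (hp : ∀ w ∈ p.1.support, w ∈ meshDomain unitDisk δ)
    (hq : ∀ w ∈ q.1.support, w ∈ meshDomain unitDisk δ) (h : toDisk δ p hp = toDisk δ q hq) :
    p = q := by
  have h' := congrArg (fun γ : DomainSAW unitDisk δ u v => γ.walk.support) h
  simp only [toDisk, SimpleGraph.Walk.support_transfer] at h'
  exact Subtype.ext (SimpleGraph.Walk.support_injective h')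

/-- **Exhaustion.** A bound on the fugacity-`x` partition functions of the discretised unit
disks `𝔻_δ`, `δ > 0`, between two fixed sites bounds the full-lattice kernel between them:
every finite family of lattice SAWs `u → v` lies in `𝔻_δ` for `δ` small. [folklore] -/
theorem latticeKernel_le_of_forall_unitDisk (x : ℝ) {u v : Site 2} {C : ℝ≥0∞}
    (hC : ∀ δ : ℝ, 0 < δ → weightAt x unitDisk δ u v univ ≤ C) : latticeKernel x u v ≤ C := by
  classical
  rw [latticeKernel, ENNReal.tsum_eq_iSup_sum]
  refine iSup_le fun s => ?_
  -- a common bound on the coordinates of all vertices of all walks of `s`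
  set N : ℕ := s.sup (fun p => p.1.length) + (u 0).natAbs + (u 1).natAbs with hN
  set δ : ℝ := meshOf N
  have hmem : ∀ p ∈ s, ∀ w ∈ p.1.support, w ∈ meshDomain unitDisk δ := by
    intro p hp w hw
    apply mem_meshDomain_unitDisk_of_abs_le
    intro i
    have h1 := abs_sub_le_length p.1 w hw i
    have h2 : p.1.length ≤ s.sup (fun p => p.1.length) := Finset.le_sup (f := fun p => p.1.length) hp
    have h3 : |u i| ≤ ((u 0).natAbs : ℤ) + (u 1).natAbs := by
      fin_cases i <;> simp
    calc |w i| = |(w i - u i) + u i| := by ring_nf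
      _ ≤ |w i - u i| + |u i| := abs_add_le _ _
      _ ≤ (p.1.length : ℤ) + (((u 0).natAbs : ℤ) + (u 1).natAbs) := add_le_add h1 h3
      _ ≤ (N : ℤ) := by rw [hN]; push_cast; linarith [(Nat.cast_le (α := ℤ)).2 h2]
  let T : {p // p ∈ s} → DomainSAW unitDisk δ u v := fun q => toDisk δ q.1 (hmem q.1 q.2)
  have hT : ∀ a ∈ s.attach, ∀ b ∈ s.attach, T a = T b → a = b :=
    fun a _ b _ hab => Subtype.ext (toDisk_inj δ _ _ hab)
  calc ∑ p ∈ s, ENNReal.ofReal (x ^ p.1.length)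
      = ∑ q ∈ s.attach, ENNReal.ofReal (x ^ (T q).length) := by
        rw [← Finset.sum_attach]; simp [T]
    _ = ∑ γ ∈ s.attach.image T, ENNReal.ofReal (x ^ γ.length) :=
        (Finset.sum_image (f := fun γ : DomainSAW unitDisk δ u v => ENNReal.ofReal (x ^ γ.length)) hT).symm
    _ ≤ ∑' γ : DomainSAW unitDisk δ u v, ENNReal.ofReal (x ^ γ.length) := ENNReal.sum_le_tsum _
    _ = weightAt x unitDisk δ u v univ := (weightAt_univ x unitDisk δ u v).symm
    _ ≤ C := hC δ (meshOf_pos N)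

/-- The unit disk is bounded. [folklore] -/
theorem isBounded_unitDisk : Bornology.IsBounded unitDisk := Metric.isBounded_ball

/-- **MAIN EQUIVALENCE (domains eliminated).** The crux holds iff the critical lattice kernel
between neighbours is uniformly bounded: `CriticalBubbleBound ⟺ ∃ C < ∞, ∀ u ∼ v, K_{x_c}(u,v) ≤ C`.
Neither `Ω`, nor `δ`, nor the "largest component" convention of `Ω_δ` play any role: the crux
is a statement about `ℤ²` alone (finiteness of the critical nearest-neighbour two-point function,
Madras–Slade 1993 p. 37: open in `d = 2, 3, 4`). [cite: MadrasSlade1993, §1.4] -/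
theorem criticalBubbleBound_iff_latticeKernel :
    CriticalBubbleBound ↔
      ∃ C : ℝ≥0∞, C ≠ ⊤ ∧ ∀ u v : Site 2, (zdGraph 2).Adj u v → latticeKernel criticalFugacity u v ≤ C := by
  constructor
  · rintro ⟨C, hC, h⟩
    refine ⟨C, hC, fun u v huv => latticeKernel_le_of_forall_unitDisk _ fun δ hδ => ?_⟩
    rw [weightAt_criticalFugacity]
    exact h unitDisk δ u v isBounded_unitDisk hδ huv
  · rintro ⟨C, hC, h⟩
    exact ⟨C, hC, fun Ω δ u v _ _ huv => (weight_univ_le_latticeKernel Ω δ u v).trans (h u v huv)⟩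

/-! ### Translation invariance and the one-number normal form -/

/-- Translation by `c`, an automorphism of `ℤ²`. [folklore] -/
def shiftIso (c : Site 2) : zdGraph 2 ≃g zdGraph 2 where
  toEquiv := Equiv.addRight c
  map_rel_iff' := zdGraph_adj_shift_iff c _ _

/-- The kernel does not decrease under translating both endpoints (hence is invariant). [folklore] -/
theorem latticeKernel_le_shift (x : ℝ) (u v c : Site 2) :
    latticeKernel x u v ≤ latticeKernel x (u + c) (v + c) := by
  let F : LatticeSAW u v → LatticeSAW (u + c) (v + c) := fun p =>
    ⟨p.1.map (shiftIso c).toHom, p.2.map (shiftIso c).injective⟩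
  have hF : Injective F := by
    rintro ⟨p, hp⟩ ⟨q, hq⟩ h
    have h' := congrArg Subtype.val h
    exact Subtype.ext (SimpleGraph.Walk.map_injective_of_injective (shiftIso c).injective u v h')
  have key : (fun p : LatticeSAW u v => ENNReal.ofReal (x ^ p.1.length)) =
      fun p => (fun q : LatticeSAW (u + c) (v + c) => ENNReal.ofReal (x ^ q.1.length)) (F p) := by
    funext p
    exact congrArg (fun n : ℕ => ENNReal.ofReal (x ^ n)) (SimpleGraph.Walk.length_map _ _).symm
  calc latticeKernel x u v
      = ∑' p : LatticeSAW u v, (fun q : LatticeSAW (u + c) (v + c) => ENNReal.ofReal (x ^ q.1.length)) (F p) := by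
        rw [latticeKernel, key]
    _ ≤ latticeKernel x (u + c) (v + c) := ENNReal.tsum_comp_le_tsum_of_injective hF _

/-- **Translation invariance** of the lattice kernel. [folklore] -/
theorem latticeKernel_shift (x : ℝ) (u v c : Site 2) :
    latticeKernel x (u + c) (v + c) = latticeKernel x u v := by
  refine le_antisymm ?_ (latticeKernel_le_shift x u v c)
  have h := latticeKernel_le_shift x (u + c) (v + c) (-c)
  simpa using h

/-- The kernel depends on the displacement only: `K_x(u,v) = K_x(0, v - u)`. [folklore] -/
theorem latticeKernel_eq_zero_sub (x : ℝ) (u v : Site 2) :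
    latticeKernel x u v = latticeKernel x 0 (v - u) := by
  have h := latticeKernel_shift x u v (-u)
  simp only [add_neg_cancel] at h
  rw [← h, sub_eq_add_neg]

/-- The **critical bubble at the unit vector `e`**: `G_{x_c}(0,e) = K_{x_c}(0,e) ∈ [0,∞]`. [cite: MadrasSlade1993, §1.4] -/
def bubble (e : Site 2) : ℝ≥0∞ := latticeKernel criticalFugacity 0 e

/-- **ONE-NUMBER NORMAL FORM.** The crux is equivalent to the finiteness of the (at most four)
numbers `G_{x_c}(0,e)`, `e` a unit vector of `ℤ²`:
`CriticalBubbleBound ⟺ ∀ e ∼ 0, G_{x_c}(0,e) < ∞`. (By the dihedral symmetry of `ℤ²` the four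
numbers coincide; numerically `G_{x_c}(0,e) ≈ 0.81`, see §8.) [cite: MadrasSlade1993, §1.4] -/
theorem criticalBubbleBound_iff_bubble_ne_top :
    CriticalBubbleBound ↔ ∀ e : Site 2, (zdGraph 2).Adj 0 e → bubble e ≠ ⊤ := by
  rw [criticalBubbleBound_iff_latticeKernel]
  constructor
  · rintro ⟨C, hC, h⟩ e he
    exact ne_top_of_le_ne_top hC (h 0 e he)
  · intro h
    classical
    -- the four unit vectors
    let U : Finset (Site 2) := {Pi.single 0 1, -Pi.single 0 1, Pi.single 1 1, -Pi.single 1 1}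
    have hU : ∀ e : Site 2, (zdGraph 2).Adj 0 e → e ∈ U := by
      intro e he
      obtain ⟨i, hi | hi⟩ := (zdGraph_adj_iff _ _).1 he
      · rw [zero_add] at hi; subst hi
        fin_cases i <;> simp [U]
      · have : e = -Pi.single i 1 := eq_neg_of_add_eq_zero_left hi.symm
        subst this
        fin_cases i <;> simp [U]
    refine ⟨∑ e ∈ U, (if (zdGraph 2).Adj 0 e then bubble e else 0), ?_, fun u v huv => ?_⟩
    · rw [ENNReal.sum_ne_top]
      intro e _
      split_ifs with he
      · exact h e he
      · exact ENNReal.zero_ne_top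
    · have hadj : (zdGraph 2).Adj 0 (v - u) := by
        have := (Zd.zdGraph_adj_sub_right u v u).2 huv
        rwa [sub_self] at this
      rw [latticeKernel_eq_zero_sub]
      calc latticeKernel criticalFugacity 0 (v - u) = (if (zdGraph 2).Adj 0 (v - u) then bubble (v - u) else 0) := by
            rw [if_pos hadj]; rfl
        _ ≤ ∑ e ∈ U, (if (zdGraph 2).Adj 0 e then bubble e else 0) :=
            Finset.single_le_sum (f := fun e => if (zdGraph 2).Adj 0 e then bubble e else 0)
              (fun _ _ => zero_le) (hU _ hadj)

/-- The unit vector `e₀ = (1, 0)`. [folklore] -/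
def e₀ : Site 2 := ![1, 0]

/-- `0 ∼ e₀`. [folklore] -/
theorem adj_zero_e₀ : (zdGraph 2).Adj 0 e₀ := by unfold e₀; decide

end Summit.CriticalPhenomena.SAWScalingLimit.Theorems.CriticalBubbleBound.Negative
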